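import Mathlib
import Literature.Computability.Complexity.RandomKSatEnsembleOGP
import Summits.PneNP.PneNP.Theorems.OverlapGapAlgebraNoStableSectionDefs
import Summits.PneNP.PneNP.Theorems.OverlapGapAlgebraNoStableSectionLadder
import Summits.PneNP.PneNP.Theorems.OverlapGapAlgebraSearchHardWindowLowDegreeStability

/-!
# Route OverlapGapAlgebra, crux `SearchHardWindow` (stmt-PneNP-2460), line `Sketch`: moat transfer
# on a path of instances

Stub `stub_moatTransfer` of the skeleton
`Summits/PneNP/PneNP/Cruxes/SearchHardWindow/Lines/Sketch.lean` (section `HS25`): the deterministic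
plumbing between the moat / ladder extraction of Huang–Sellke 2025 (arXiv:2501.06427, Lemmas
3.24–3.25 = Bresler–Huang 2021, arXiv:2106.02129, Prop. 4.6 / Lemma 4.8; the landed `stub_moat`,
handed in as the hypothesis `hMoat`) and the two events of the named fact
`HuangSellke2025KSatObstructions` (HS25 Lemmas 3.22–3.23).

Along a path `z 0, z 1, …` of literal arrays, a deterministic algorithm outputs the sign vectors
`x t = (decide (0 ≤ F (curry (z t)) v))_v`. If, up to the horizon `T ≥ k W`, every output is
saturated (`|F v| ≥ 1`) and solves its instance (`hgood`), consecutive real outputs move by at most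
`θ n` in squared norm (`hclose`, with `h₂(θ) ≤ η`, `θ ≤ 1/2`), and no CHAOS structure with integer
gap `W` exists (`hnochaos`), then the OGP structure exists.

* `mtr_overlapCondEnt_eq_condEnt` — the bridge: Bresler–Huang's (unordered) conditional overlap
  entropy `overlapCondEnt Y ℓ` is the DartGame ordered conditional type entropy `condEnt` of the
  rung-`0`-normalised sequence `fun j i => Y j i ⊕ Y 0 i` (both are the same sums).
* stability (`mtr_stab`): `d_H(x t, x (t+1)) ≤ ‖F(z t) − F(z (t+1))‖² ≤ θ n ≤ n/2`
  (`wld_hammingDist_le_sum_sq`) and `h₂(d_H/n) ≤ h₂(θ) ≤ η` by monotonicity of `h₂` on `[0, 1/2]`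
  (`Real.binEntropy_strictMonoOn`).
* chaos-freeness (`mtr_chaos`): a candidate `x t` at a time `t ≥ ts j + W` for all earlier rung
  times is, with the time tuple `(ts 0, …, ts (ℓ-1), t)`, a CHAOS structure unless its conditional
  overlap entropy exceeds `β`.
* the ladder `ts` produced by `hMoat` is the OGP structure (`ladder_le_mul`, `ladder_mono`).
-/

set_option linter.dupNamespace false -- `Summit.PneNP.PneNP.…`: summit = sub-problem

namespace Summit.PneNP.PneNP.Theorems

open Finset
open Literature.Computability.Complexity
open Summit.PneNP.PneNP.Cruxes.NoStableSection.DartGame (condEnt typeEnt patCount withRung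
  withRung_of_lt withRung_of_le condEnt_congr ladder_le_mul ladder_mono)
open scoped Classical

/-! ## The bridge: unordered conditional overlap entropy = ordered entropy of the normalised sequence -/

/-- Bresler–Huang's overlap-pattern count of `Y` is the DartGame pattern count of the
rung-`0`-normalised sequence `fun j i => Y j i ⊕ Y 0 i`. -/
theorem mtr_overlapPatCount_eq_patCount {n : ℕ} (Y : ℕ → Fin n → Bool) (ℓ : ℕ)
    (ξ : Fin ℓ → Bool) :
    overlapPatCount Y ℓ ξ = patCount (fun j i => Bool.xor (Y j i) (Y 0 i)) ℓ ξ := rfl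

/-- Bresler–Huang's overlap entropy of `Y` is the DartGame type entropy of the rung-`0`-normalised
sequence. -/
theorem mtr_overlapEnt_eq_typeEnt {n : ℕ} (Y : ℕ → Fin n → Bool) (ℓ : ℕ) :
    overlapEnt Y ℓ = typeEnt (fun j i => Bool.xor (Y j i) (Y 0 i)) ℓ := rfl

/-- **The bridge.** Bresler–Huang's (unordered) conditional overlap entropy `overlapCondEnt Y ℓ`
is the DartGame ordered conditional type entropy `condEnt` of the rung-`0`-normalised sequence
`fun j i => Y j i ⊕ Y 0 i`. -/
theorem mtr_overlapCondEnt_eq_condEnt {n : ℕ} (Y : ℕ → Fin n → Bool) (ℓ : ℕ) :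
    overlapCondEnt Y ℓ = condEnt (fun j i => Bool.xor (Y j i) (Y 0 i)) ℓ := rfl

/-! ## Stability of the saturated sign map along the path -/

/-- One step of the path: if the output at time `t` is saturated and the real outputs move by at
most `θ n` in squared norm, `θ ≤ 1/2`, `h₂(θ) ≤ η`, then the sign vectors are at Hamming distance
`Δ ≤ n / 2` with `h₂(Δ/n) ≤ η`. -/
theorem mtr_stab {n : ℕ} {θ η : ℝ} (hθ : θ ≤ 1 / 2) (hθη : Real.binEntropy θ ≤ η) (hn : 1 ≤ n)
    {y y' : Fin n → ℝ} (hsat : ∀ v, 1 ≤ |y v|) (hclose : ∑ v, (y v - y' v) ^ 2 ≤ θ * n) :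
    (hammingDist (fun v => decide (0 ≤ y v)) (fun v => decide (0 ≤ y' v)) : ℝ) ≤ n / 2 ∧
      Real.binEntropy
        ((hammingDist (fun v => decide (0 ≤ y v)) (fun v => decide (0 ≤ y' v)) : ℝ) / n) ≤ η := by
  have hnr : (0 : ℝ) < n := by exact_mod_cast hn
  have hΔ : (hammingDist (fun v => decide (0 ≤ y v)) (fun v => decide (0 ≤ y' v)) : ℝ) ≤ θ * n :=
    (wld_hammingDist_le_sum_sq hsat).trans hclose
  have hdiv : (hammingDist (fun v => decide (0 ≤ y v)) (fun v => decide (0 ≤ y' v)) : ℝ) / n ≤ θ :=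
    by rw [div_le_iff₀ hnr]; exact hΔ
  have hdiv0 :
      0 ≤ (hammingDist (fun v => decide (0 ≤ y v)) (fun v => decide (0 ≤ y' v)) : ℝ) / n := by
    positivity
  have hθ0 : 0 ≤ θ := hdiv0.trans hdiv
  refine ⟨?_, ?_⟩
  · calc (hammingDist (fun v => decide (0 ≤ y v)) (fun v => decide (0 ≤ y' v)) : ℝ)
        ≤ θ * n := hΔ
      _ ≤ 1 / 2 * n := mul_le_mul_of_nonneg_right hθ hnr.le
      _ = n / 2 := by ring
  · calc Real.binEntropy
          ((hammingDist (fun v => decide (0 ≤ y v)) (fun v => decide (0 ≤ y' v)) : ℝ) / n)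
        ≤ Real.binEntropy θ :=
          Real.binEntropy_strictMonoOn.monotoneOn ⟨hdiv0, hdiv.trans (by linarith)⟩
            ⟨hθ0, by linarith⟩ hdiv
      _ ≤ η := hθη

/-! ## The stub -/

/-- **Moat transfer on a path of instances** (stub `stub_moatTransfer` of line `Sketch`, section
`HS25`; Huang–Sellke 2025, arXiv:2501.06427 §3.3.2, the deterministic step of the proof of
Cor. 3.21): along a path `z` of literal arrays on which, up to time `T ≥ k W`, the saturated sign map
of `F` solves every instance (`hgood`) and consecutive real outputs move by `≤ θ n` in squared norm
(`hclose`, `h₂(θ) ≤ η`, `θ ≤ 1/2`), if no CHAOS structure with integer gap `W` exists (`hnochaos`: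
every satisfying candidate at a time `≥ W` after the previous rung has conditional overlap entropy
`> β` given the earlier outputs), then an OGP structure exists (times `t 0 ≤ ⋯ ≤ t k ≤ T`,
assignments solving the instances at those times, all conditional overlap entropies in
`[β − η, β]`) — via the moat `hMoat` (the landed `stub_moat`), `wld_hammingDist_le_sum_sq`, the
monotonicity of `h₂` on `[0, 1/2]`, and the bridge `mtr_overlapCondEnt_eq_condEnt`. -/
theorem stub_moatTransfer
    (hMoat : ∀ (n k W T : ℕ) (x : ℕ → (Fin n → Bool)) (β η : ℝ), 0 < W → 0 < η → η < β →
      k * W ≤ T →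
      (∀ t < T, (hammingDist (x t) (x (t + 1)) : ℝ) ≤ n / 2 ∧
        Real.binEntropy ((hammingDist (x t) (x (t + 1)) : ℝ) / n) ≤ η) →
      (∀ (ℓ : ℕ) (ts : ℕ → ℕ) (t : ℕ), 1 ≤ ℓ → ℓ ≤ k → ts 0 = 0 →
        (∀ j, j + 1 < ℓ → ts j < ts (j + 1)) → (∀ j < ℓ, ts j + W ≤ t) → t ≤ T →
        β < condEnt (fun j i => Bool.xor (withRung (fun j => x (ts j)) ℓ (x t) j i) (x (ts 0) i))
          ℓ) →
      ∃ ts : ℕ → ℕ, ts 0 = 0 ∧ (∀ ℓ < k, ts ℓ < ts (ℓ + 1) ∧ ts (ℓ + 1) ≤ ts ℓ + W) ∧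
        ∀ ℓ, 1 ≤ ℓ → ℓ ≤ k →
          condEnt (fun j i => Bool.xor (x (ts j) i) (x (ts 0) i)) ℓ ∈ Set.Icc (β - η) β)
    (n m k W T : ℕ) (β η θ : ℝ) (hW : 0 < W) (hη : 0 < η) (hηβ : η < β)
    (hT : k * W ≤ T) (hθ : θ ≤ 1 / 2) (hθη : Real.binEntropy θ ≤ η) (hn : 1 ≤ n)
    (F : (Fin m → Fin k → Fin n × Bool) → Fin n → ℝ) (z : ℕ → (Fin m × Fin k → Fin n × Bool))
    (hgood : ∀ t ≤ T, (∀ v, 1 ≤ |F (Function.curry (z t)) v|) ∧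
      ∀ i : Fin m, ∃ j : Fin k,
        decide (0 ≤ F (Function.curry (z t)) (z t (i, j)).1) = (z t (i, j)).2)
    (hclose : ∀ t < T,
      ∑ v, (F (Function.curry (z t)) v - F (Function.curry (z (t + 1))) v) ^ 2 ≤ θ * n)
    (hnochaos : ∀ (j : ℕ) (t : ℕ → ℕ) (x : Fin n → Bool), 1 ≤ j → j ≤ k →
      (∀ ℓ < j, t ℓ ≤ t (ℓ + 1)) → t j ≤ T → t (j - 1) + W ≤ t j →
      (∀ i : Fin m, ∃ j' : Fin k, x (z (t j) (i, j')).1 = (z (t j) (i, j')).2) →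
      β < overlapCondEnt
        (fun ℓ => if ℓ < j then (fun v => decide (0 ≤ F (Function.curry (z (t ℓ))) v)) else x) j) :
    ∃ (t : ℕ → ℕ) (x : ℕ → Fin n → Bool), (∀ ℓ < k, t ℓ ≤ t (ℓ + 1)) ∧ t k ≤ T ∧
      (∀ ℓ ≤ k, ∀ i : Fin m, ∃ j : Fin k, x ℓ (z (t ℓ) (i, j)).1 = (z (t ℓ) (i, j)).2) ∧
      ∀ ℓ, 1 ≤ ℓ → ℓ ≤ k → overlapCondEnt x ℓ ∈ Set.Icc (β - η) β := by
  -- the chain of outputs of the saturated sign map along the path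
  set x : ℕ → Fin n → Bool := fun t v => decide (0 ≤ F (Function.curry (z t)) v) with hxdef
  -- (1) stability: consecutive outputs are `h₂`-close before the horizon
  have hstab : ∀ t < T, (hammingDist (x t) (x (t + 1)) : ℝ) ≤ n / 2 ∧
      Real.binEntropy ((hammingDist (x t) (x (t + 1)) : ℝ) / n) ≤ η :=
    fun t ht => mtr_stab hθ hθη hn (hgood t ht.le).1 (hclose t ht)
  -- (2) chaos-freeness for increasing rung times starting at `0`
  have hchaos : ∀ (ℓ : ℕ) (ts : ℕ → ℕ) (t : ℕ), 1 ≤ ℓ → ℓ ≤ k → ts 0 = 0 →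
      (∀ j, j + 1 < ℓ → ts j < ts (j + 1)) → (∀ j < ℓ, ts j + W ≤ t) → t ≤ T →
      β < condEnt (fun j i => Bool.xor (withRung (fun j => x (ts j)) ℓ (x t) j i) (x (ts 0) i))
        ℓ := by
    intro ℓ ts t hℓ1 hℓk _hts0 hinc hwin htT
    -- the time tuple `(ts 0, …, ts (ℓ-1), t, t, …)` and the candidate `x t`
    have key := hnochaos ℓ (fun i => if i < ℓ then ts i else t) (x t) hℓ1 hℓk
      (fun i hi => by
        by_cases hi1 : i + 1 < ℓ
        · rw [if_pos hi, if_pos hi1]; exact (hinc i hi1).le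
        · rw [if_pos hi, if_neg hi1]; have := hwin i hi; omega)
      (by rw [if_neg (lt_irrefl ℓ)]; exact htT)
      (by rw [if_pos (Nat.sub_lt hℓ1 Nat.one_pos), if_neg (lt_irrefl ℓ)]; exact hwin _ (by omega))
      (by rw [if_neg (lt_irrefl ℓ)]; exact (hgood t htT).2)
    -- the sequence read by `hnochaos` is `withRung (x ∘ ts) ℓ (x t)`
    have hY : (fun i => if i < ℓ then
        (fun v => decide (0 ≤ F (Function.curry (z (if i < ℓ then ts i else t))) v)) else x t) =
        withRung (fun j => x (ts j)) ℓ (x t) := by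
      funext i
      by_cases hi : i < ℓ
      · rw [if_pos hi, if_pos hi, withRung_of_lt _ _ _ hi]
      · rw [if_neg hi, withRung_of_le _ _ _ (not_lt.mp hi)]
    rw [hY, mtr_overlapCondEnt_eq_condEnt, withRung_of_lt _ _ _ hℓ1] at key
    exact key
  -- (3) the moat produces the ladder
  obtain ⟨ts, h0, hgap, hband⟩ := hMoat n k W T x β η hW hη hηβ hT hstab hchaos
  have hk : ts k ≤ T := (ladder_le_mul h0 hgap k le_rfl).trans hT
  refine ⟨ts, fun ℓ => x (ts ℓ), fun ℓ hℓ => (hgap ℓ hℓ).1.le, hk, fun ℓ hℓ => ?_, fun ℓ h1 h2 => ?_⟩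
  · -- the output at time `ts ℓ ≤ ts k ≤ T` solves its instance
    exact (hgood (ts ℓ) ((ladder_mono hgap k le_rfl ℓ hℓ).trans hk)).2
  · -- the band, through the bridge
    rw [mtr_overlapCondEnt_eq_condEnt]
    exact hband ℓ h1 h2

end Summit.PneNP.PneNP.Theorems
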